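import Literature.MathematicalPhysics.QuantumFieldTheory.Balaban1983to89.B1Ineq353Proof
import Literature.MathematicalPhysics.QuantumFieldTheory.Balaban1983to89.B2Lemma23Proof
import Literature.MathematicalPhysics.QuantumFieldTheory.Balaban1983to89.B2Lemma25Torus
import Literature.MathematicalPhysics.QuantumFieldTheory.Balaban1983to89.B5Leaf235Torus

/-!
# `Balaban1983to89.B2Lemma23Torus` — T. Bałaban, *(Higgs)₂,₃ quantum fields in a finite volume. II. An upper bound*,
# Commun. Math. Phys. **86** (1982) 555–594 [Balaban1982Higgs2]: **Lemma 2.3** (2.59)–(2.60) p. 571 for BAŁABAN'S OWN MINIMIZER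
# `A^{(k)} = a_kζ^{(k)}G_kQ_k^*A` (2.54) on the torus, with the inputs of its printed proof — Proposition 2.2 (2.58) for
# `G_kQ_k^*` and `∂^ηG_kQ_k^*`, the row sum (2.63), the volume and the scale comparisons — DISCHARGED by tree theorems; the
# restrictions (2.55) on `A` and the printed properties (2.44) of the cutoff `ζ^{(k)}` remain, as in print, the hypotheses

statement-level skeleton of published theorems with citation tags; proofs where landed; nothing here is a claim about the Yang–Mills mass gap

PDF held: `paper:balaban1982-cmp86-higgs23-ii` (journal page = PDF page + 554); pp. 566, 569–571 read on the ×2 renders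
`run/shared/lean/pub/pub-balaban/b2b-balaban-ref1/pages/1982-cmp86-higgs23-II/1982-cmp86-higgs23-II-p012/p015/p016/p017-x2.png`;
part I [Balaban1982Higgs1] = `paper:balaban1982-cmp85-higgs23-i` (journal page = PDF page + 602), pp. 605, 608, 610.

CITATION HEADER / WHAT IS REPRODUCED.  Cell `lit-balaban` (HOME `run/shared/lean/pub/lit-balaban/`), Phase-2 proof seat **p23**
gen 6 (unit `lit-balaban-p23-g6`); SKELETON row **B2.Lem2.3** (decl of record `…B2Sect2Statements.Lemma23Printed`, r02 p239259;
twin `…B2StepK.Lemma23Printed`, r14 p239461 — both UNCHANGED), fold owner r02, referee ref-4.  The row was PROVED FOR THE MODEL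
FAMILY by `…B2Lemma23Proof` (p23 gen 4, p247772): there ONE instance `KernelModel23` carries the kernel `a_k(G_kQ_k^*)(x, y′)`
TOGETHER WITH the Proposition 2.2 shapes (2.58) for `G_kQ_k^*` and `∂^ηG_kQ_k^*` (`kerK`, `kerK_sh`, `kerDK`), the number
`κ = a_kG_kQ_k^*1` of (2.63) (`sumK`, `kappa`), the radius bound (`sep`), the scale comparison (`q_le`) and the lattice volume
(`summable`) as DATA — so the fold owner kept the row's head `typed-existing` («the frames carry the Prop 2.2 / I.2.2 decay shapes
— typed antecedents», r02 2026-08-21T05:41Z).  THIS FILE DISCHARGES EVERY ONE OF THOSE FIELDS for Bałaban's ACTUAL operators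
(the companion `…B2Lemma25Torus`, p254202, does the same for Lemma 2.5):

* (2.44) p. 566 / (2.54) p. 569: *"A^{(k)} = a_kζ^{(k)}G_kQ_k^*A"* with `G_k` the covariance of the VECTOR field — B1 p. 608 [PDF 6]:
  *"The renormalization transformations for vector fields will be obtained by taking N = d and an external vector field A = 0"*,
  (I.1.11) the Feynman-gauge kinetic term `½⟨A,(−Δ^ε + μ₀²)A⟩`: component by component `G_k` is the ZERO-FIELD scalar operator
  `(−Δ^η + μ₀²(L^kε)² + a_kQ_k^*Q_k)⁻¹` of (2.62) (rescaled to the unit lattice `T₁^{(k)}`, fine lattice `T_η`, `η = L^{−k}`, p. 570),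
  i.e. the tree's `B5Display136Torus.Grs P a μ₀² k` on `Setup`'s tori (`B1RG242Torus`: `Q_k = Qk`, `Q_k^* = Qks`, `a_k = B1.aSeq`);
  p. 571: *"Let us notice that the conclusions of Proposition 2.2 hold for G_kQ_k^*."*
* (2.58) for `G_kQ_k^*` at zero field on the torus, uniformly in the volume and the level: `B4Ineq116Torus.GQ_decay_torus` (B4's
  Lemma 2.4 (2.35) first quantity) ⇒ the fields `kerK`, `kerK_sh`; (2.58) for `∂^η_xG_kQ_k^*`: the kernel `K1_k(μ; x, y) =
  L^k[(G_kQ_k^*)(x + e_μ, y) − (G_kQ_k^*)(x, y)]` (`B5Leaf235Torus.K1_mk`) obeys `|K1_k| ≤ c₀e^{−δ₀|x − y|}` (`K1_decay_torus_level`,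
  read off `B5Leaf235Torus.K13_bound_of`, (2.35) second quantity) ⇒ the field `kerDK`.
* (2.62)–(2.63) p. 571, verbatim: *"The third term can be calculated in the following way G_kQ_k^*1 = a_k⁻¹G_ka_kP_kQ_k^*1 =
  a_k⁻¹G_k(−Δ^η + μ₀²(L^kε)² + a_kP_k)1 − (μ₀²(L^kε)²/a_k)G_kQ_k^*1. (2.62) Hence (a_kG_kQ_k^*1)(x) = 1 − μ₀²(L^kε)²/(a_k + μ₀²(L^kε)²),
  (2.63)"* — PROVED for the tower (`aGQ_rowSum`: on the torus `Q_k^*1 = 1` and `G_k1 = (a_k + μ₀²(L^kε)²)⁻¹1`, `B2Lemma25Torus`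
  §1; printed form `display263_value`) ⇒ the fields `sumK`, `sumK_sh` at EVERY fine point, and `kappa` (`kappa23_le`: `K₁ =
  c₁Lμ₀/(a(1 − L⁻²))`, no side condition on `μ₀L^kε`).
* the volume `Σ_{y′∈T₁^{(k)}} e^{−½δ₀|x − y′|} ≤ e^{½δ₀}K_d(½δ₀)` (`B5Ineq137Torus.rowFine_le`) ⇒ `summable`; the radius `½r(L^kε)`
  of (2.44) against the threshold `c₁/(μ₀L^{k−1}ε)` of (2.55)₂ (`B2Lemma23Proof.sep23_of_rDecay` + `exists_C₁_rDecay4`, r14's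
  `rDecayBeatsPowers`) ⇒ `sep`; the one-scale comparison `p(L^{k−1}ε) ≤ (1 + log L)^p·p(L^kε)` (`pFn_div_le`) ⇒ `q_le`; one fine
  step moves `|x − y′|` by `≤ η` (`abs_dXU_shift_sub_le`) ⇒ `d_le_sh`, `sh_le_d`.

WHAT REMAINS A HYPOTHESIS — exactly what print uses as one.  (a) *"Under the restrictions (2.55)"* (p. 571): (2.55) p. 570 on the
field `A` over `Λ₋₁^{(k−1)′}` (`TorusInst23.RestrT` = the carrier's `restr255`, in the p247772 reading: (2.55)₂ verbatim `|A(x)| ≤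
(c₁/(μ₀L^{k−1}ε))p(L^{k−1}ε)` for `x ∈ Λ₋₁^{(k−1)′}`, and (2.55)₁ `|(∂A)(b)| ≤ c₁p(L^{k−1}ε)` INTEGRATED along lattice paths,
`|A(y′) − A(y)| ≤ p(L^{k−1}ε)(r₁ + r₂|x − y′|)` within the range of `ζ^{(k)}`).  (b) *"the properties of the function ζ^{(k)}"*
(p. 571): the cutoff `ζ^{(k)}(x, y)` of (2.44) is a DATUM of the instance carrying exactly its printed properties (p. 566: *"is
"smooth" with respect to x in the sense that |(∂^η_xζ^{(k)})(b, y)| ≦ 1, supp ζ^{(k)}(·, y) is contained in the set {x ∈ T_η :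
|x − y| < r(L^kε) − 2M} and ζ^{(k)}(x, y) = 1 if |x − y| ≦ ½r(L^kε)"*, plus `|ζ^{(k)}| ≤ 1`) — the theorem holds for EVERY such
cutoff; §5 exhibits one (`zetaPL`).  (c) The geometry of the regions: `Λ₋₁^{(k−1)′} ⊇ Λ₂^{(k−1)′}` are finite sets of sites of
`T₁^{(k)}` with the standing assumption `nbhd` that the range of `ζ^{(k)}` (plus one fine step) around `B^k(Λ₂^{(k−1)′})` lies in
`Λ₋₁^{(k−1)′}` (print: the sets `Λ_i` of (2.9)–(2.10) are separated by `r(L^kε)`, p. 570).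

MAIN RESULTS.  `TorusConsts23` = the constants fixed BEFORE the instance (d, L, a, μ₀, R, r, M, b₀, p, c₁, r₁, r₂; `.Valid` = the
printed ranges); `Certified23`/`exists_certified23`/`cert23` = the uniform (2.58) constants with certificates; `consts23 Q hQ :
B2Lemma23Proof.Consts23`; `TorusInst23 Q` = ONE STEP k on ONE TORUS (volume `P`, level `1 ≤ k ≤ m + K` with `L^kε ≤ 1`, regions,
field component `A`, cutoff `ζ`); `toKM23 Q hQ ι : B2Lemma23Proof.KernelModel23 …` the instance with ALL proof fields discharged
(§3); `restr_iff` (the model's restriction predicate is (2.55) on `Λ₋₁`), `Ak_model_eq` (the model's `A^{(k)}` is (2.54));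
**`lemma23_torus_pointwise`** `|A^{(k)}(x) − A(y)| ≤ 𝒞·p(L^kε)` and **`lemma23_torus_deriv_pointwise`** `|(∂^η_μA^{(k)})(x)| ≤
𝒞·p(L^kε)` for `x ∈ B^k(y)`, `y ∈ Λ₂^{(k−1)′}`, `𝒞 = Consts23.O1 (consts23 Q hQ)`; the decl of record **`lemma23Printed_torus :
B2Sect2Statements.Lemma23Printed (famTorus23 Q)`** and the twin **`lemma23Printed_torus_StepK : B2StepK.Lemma23Printed
(famTorus23StepK Q)`** for the family of ALL instances of a valid window; §5 non-vacuity (`zetaPL` has the properties (2.44); the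
window `Q₀`, the instance `ι₁`, the hypotheses are inhabited).

DICTIONARY (print ↦ Lean).  `T_η` (fine lattice, `η = L^{−k}`) ↦ `Site ι.P 0`; `T₁^{(k)}` ↦ `Site ι.P ι.j`; `x + ηe_μ` ↦ `Site.shift x μ`;
`x ∈ B^k(y)` ↦ `Site.proj k k x = y`; `Λ₋₁^{(k−1)′}`, `Λ₂^{(k−1)′}` ↦ `ι.Λ₁ ⊇ ι.Λ₂`; `B^k(Λ₂^{(k−1)′})` ↦ `ι.good`; `a_k(G_kQ_k^*)(x, y′)` ↦
`ι.K x y′ = B1.aSeq a L k * (Grs ι.P a μ₀² k * Qks ι.P k) x y′`; `A^{(k)}(x)` ↦ `ι.Ak x = Σ_{y′} ζ(x,y′)K(x,y′)A(y′)` ((2.54));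
`(∂^η_μA^{(k)})(x)` ↦ `ι.dAk μ x`; `|x − y′|` ↦ `ι.d x y′ = dXU ι.P k x ⟨k, y′⟩` (the rescaled sup torus distance through corner
representatives, `B5Ineq137Torus`); `L^kε` ↦ `ι.ℓ`; `p(L^kε)`, `p(L^{k−1}ε)`, `r(L^kε)` ↦ `ι.p`, `ι.q` (`q_eq`), `B2.rFn Q.Rr Q.r ι.ℓ`;
`c₁/(μ₀L^{k−1}ε)` ↦ `ι.tA` (`tA_eq`); `a_kG_kQ_k^*1` ↦ `ι.κ` (`K_rowSum`, `κ_eq_display263`); `r(L^kε) − 2M`, `½r(L^kε)` ↦ `ι.ρ`, `ι.ρ₁`.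

HONEST SCOPE.  (i) The identification "vector-field covariance = zero-field scalar tower at m² = μ₀², componentwise" is B1's
printed sentence (p. 608) with (I.1.11); it is NOT re-derived here from `HiggsLattice.action`.  (ii) Distances are the tree's
`d_{XU}` (block corners as representatives of `y′ ∈ T₁^{(k)}`; any other representative convention differs by `≤ 1`, absorbed in
the constants); print's strict `<` in the support condition of (2.44) is weakened to `≤` (a weaker requirement on `ζ`).  (iii) The
hypothesis on `A` is the p247772 READING of (2.55): (2.55)₂ verbatim on `Λ₋₁^{(k−1)′}` and (2.55)₁ in INTEGRATED form with family
parameters `r₁, r₂` (print's bondwise bound yields it along lattice paths inside `Λ₋₁`; the path-existence step is NOT transcribed).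
(iv) The regions are data with the standing assumption (c); the chain (2.9)–(2.10) producing them is not transcribed, and
(2.59)–(2.60) are asserted on all of `B^k(Λ₂)`.  (v) The tori are `Setup`'s (`2L^{m+K−k}` sites per direction, `L` odd); levels
`1 ≤ k ≤ m + K` with `L^kε ≤ 1`.  (vi) Constants `δ₀, c₀, C₁` are existential (those of the cited torus theorems), chosen once per
window by `Classical.choice` (`cert23`), so `𝒞` is not numerical.  (vii) `A` is one real component ((2.59)–(2.60) are componentwise
at zero external field).  (viii) Nothing about Proposition 2.2 at `A ≠ 0` or on regions `Ω ≠ T`, Proposition 2.1, or the integral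
(2.53).  No `sorry`, no new `def … : Prop` leaf, axioms standard; value = kernel certificate (bookkeeping over the tree's own
theorems), NOT summit progress.
-/

namespace Literature.MathematicalPhysics.QuantumFieldTheory.Balaban1983to89.B2Lemma23Torus

open Finset Matrix Real
open Literature.MathematicalPhysics.QuantumFieldTheory.Balaban1983to89
open B1RG242Torus B5Display136Torus B4Ineq115Torus B5Ineq137Torus B5Leaf237C0Torus B4Ineq116Torus B5Leaf235Torus
open B2Lemma23Proof

noncomputable section

/-! ## §1. (2.62)–(2.63) for the concrete tower: the row sums of `a_kG_kQ_k^*` -/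

section RowSum

variable {P : Params}

/-- **(2.63)** p. 571 for the tower: `(a_jG_jQ_j^*1)(x) = a_j/(a_j + μ₀²(L^jε)²)` at EVERY fine point — on the torus `Q_j^*1 = 1`
(`B2Lemma25Torus.Qks_mulVec_const`) and `G_j1 = (a_j + μ₀²(L^jε)²)⁻¹1` (`B2Lemma25Torus.Grs_mulVec_const`: the constants are
eigenvectors of `−Δ + μ₀²(L^jε)² + a_jQ_j^*Q_j`), which is the content of the printed computation (2.62) *"G_kQ_k^*1 =
a_k⁻¹G_ka_kP_kQ_k^*1 = a_k⁻¹G_k(−Δ^η + μ₀²(L^kε)² + a_kP_k)1 − (μ₀²(L^kε)²/a_k)G_kQ_k^*1"*. [cite: Balaban1982Higgs2, (2.62)–(2.63) p.571] -/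
theorem aGQ_rowSum {a msq : ℝ} (ha : 0 < a) (hm : 0 ≤ msq) {j : ℕ} (hj : 1 ≤ j) (x : Site P 0) :
    ∑ y' : Site P j, B1.aSeq a P.L j * (Grs P a msq j * Qks P j) x y'
      = B1.aSeq a P.L j / (P.spacing j ^ 2 * msq + B1.aSeq a P.L j) := by
  rw [← Finset.mul_sum]
  have h1 : ∑ y' : Site P j, (Grs P a msq j * Qks P j) x y' = ((Grs P a msq j * Qks P j) *ᵥ fun _ => (1 : ℝ)) x := by
    simp [Matrix.mulVec, dotProduct]
  rw [h1, ← Matrix.mulVec_mulVec, B2Lemma25Torus.Qks_mulVec_const, B2Lemma25Torus.Grs_mulVec_const ha hm hj]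
  simp [div_eq_mul_inv]

/-- The printed form of the number (2.63): `a_k/(a_k + μ₀²ℓ²) = 1 − μ₀²ℓ²/(a_k + μ₀²ℓ²)`. [cite: Balaban1982Higgs2, (2.63) p.571] -/
theorem display263_value {ak m : ℝ} (hak : 0 < ak) (hm : 0 ≤ m) : ak / (m + ak) = 1 - m / (ak + m) := by
  have h : ak + m ≠ 0 := by positivity
  rw [add_comm m ak, eq_sub_iff_add_eq, ← add_div, div_self h]

end RowSum

/-! ## §2. The fixed constants; Proposition 2.2 (2.58) for `G_kQ_k^*`, `∂^ηG_kQ_k^*` at zero field on the torus, uniformly -/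

/-- **(2.58) for `∂^ηG_jQ_j^*` AT ZERO FIELD ON THE TORUS, LEVEL-WISE AND UNIFORMLY IN THE VOLUME**: for `d ≥ 1`, odd `L > 1`,
`a > 0` and a mass cap `m²₊` there are `δ₀ > 0`, `c₀ ≥ 0` (functions of `d, L, a, m²₊` only) with
`|K1_j(μ; x, y)| ≤ c₀e^{−δ₀ d_{XU}(x, (j,y))}` for every volume, every `m² ≥ 0`, every level `1 ≤ j ≤ m + K` under the cap at
`j`, where `K1_j(μ; x, y) = L^j[(G_j^{resc}Q_j^*)(x + e_μ, y) − (G_j^{resc}Q_j^*)(x, y)]` (`B5Leaf235Torus.K1_mk`) is the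
`η = L^{−j}` difference quotient of `G_jQ_j^*` in `x` — B4's Lemma 2.4 (2.35) second quantity on the torus
(`B5Leaf235Torus.K13_bound_of`, stated there under a top level `k > j`; here read off at the level itself).
[cite: Balaban1983RegularityDecay, Lemma 2.4 (2.35) p.582 with p.572 (torus)] [cite: Balaban1982Higgs2, Prop. 2.2 (2.58) p.570] -/
theorem K1_decay_torus_level (d L : ℕ) (hd : 1 ≤ d) (hL : Odd L ∧ 1 < L) {a : ℝ} (ha : 0 < a) (m2plus : ℝ) :
    ∃ δ₀ c₀ : ℝ, 0 < δ₀ ∧ 0 ≤ c₀ ∧ ∀ (P : Params), P.d = d → P.L = L → ∀ (msq : ℝ), 0 ≤ msq →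
      ∀ j : ℕ, 1 ≤ j → j ≤ P.m + P.K → P.spacing j ^ 2 * msq ≤ m2plus →
        ∀ (μ : Fin P.d) (x : Site P 0) (y : Site P j),
          |K1 P a msq j μ x ⟨j, y⟩| ≤ c₀ * Real.exp (-(δ₀ * dXU P j x ⟨j, y⟩)) := by
  obtain ⟨d', rfl⟩ : ∃ d', d = d' + 1 := ⟨d - 1, by omega⟩
  haveI : NeZero L := ⟨by have := hL.2; omega⟩
  have hL1 : (1 : ℝ) < L := by exact_mod_cast hL.2
  obtain ⟨κ, M, hκ, hM, hdec⟩ := decayHypD_exists d' L ha hL1 m2plus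
  refine ⟨κ / (d' + 1), c13 d' κ M, by positivity, c13_nonneg d' hκ hM, ?_⟩
  intro P hPd hPL msq hmsq j hj1 hj hcap μ x y
  obtain ⟨dP, LP, mP, KP, hdP, hLP⟩ := P
  simp only at hPd hPL
  subst hPd hPL
  exact (K13_bound_of d' LP mP KP hLP ha hκ hM hdec hmsq hj1 hj hcap μ x y).1

/-- The constants chosen BEFORE the instance: the dimension `d`, the block size `L`, the constant `a` of `a_k`
((I.2.21), p. 557), the vector-field mass `μ₀` ((I.1.11), (2.63)), `R, r` of `r(ε) = R(1 + log ε⁻¹)^r` ((2.7) p. 558; the radii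
of (2.44)), `M` of (2.44) (`supp ζ^{(k)}(·, y) ⊂ {|x − y| < r(L^kε) − 2M}`), `b₀, p` of `p(ε) = b₀(1 + log ε⁻¹)^p` (p. 557),
`c₁` of the restrictions (2.55), and `r₁, r₂` of the integrated (2.55)₁ (p247772 reading).
[cite: Balaban1982Higgs2, pp.557–558, (2.44) p.566, (2.55) p.570] -/
structure TorusConsts23 where
  /-- dimension d -/
  d : ℕ
  /-- block size L -/
  L : ℕ
  /-- the constant a of a_k -/
  a : ℝ
  /-- the vector-field mass μ₀ -/
  μ₀ : ℝ
  /-- R of r(ε) = R(1 + log ε⁻¹)^r -/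
  Rr : ℝ
  /-- r of r(ε) -/
  r : ℝ
  /-- M of (2.44) -/
  M : ℝ
  /-- b₀ of p(ε) = b₀(1 + log ε⁻¹)^p -/
  b₀ : ℝ
  /-- p of p(ε) -/
  pexp : ℝ
  /-- c₁ of (2.55) -/
  c₁ : ℝ
  /-- restriction constant r₁ (integrated (2.55)₁) -/
  r₁ : ℝ
  /-- restriction constant r₂ (integrated (2.55)₁) -/
  r₂ : ℝ

/-- The printed ranges: `d ≥ 1`, `L` odd `> 1` (`Setup`), `a > 0`, `μ₀ > 0`, `R > 0`, `r > 1` ((2.7)), `M ≥ 0`, `b₀ ≥ 0`, `p ≥ 0`,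
`c₁ ≥ 0`, `r₁, r₂ ≥ 0`. [cite: Balaban1982Higgs2, pp.557–558, (2.44) p.566, (2.55) p.570] -/
structure TorusConsts23.Valid (Q : TorusConsts23) : Prop where
  hd : 1 ≤ Q.d
  hL : Odd Q.L ∧ 1 < Q.L
  ha : 0 < Q.a
  hμ₀ : 0 < Q.μ₀
  hRr : 0 < Q.Rr
  hr : 1 < Q.r
  hM : 0 ≤ Q.M
  hb₀ : 0 ≤ Q.b₀
  hpexp : 0 ≤ Q.pexp
  hc₁ : 0 ≤ Q.c₁
  hr₁ : 0 ≤ Q.r₁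
  hr₂ : 0 ≤ Q.r₂

/-- Uniform constants `δ₀ > 0`, `c₀ ≥ 0`, `C₁ ≥ 0` for the window `(d, L, a, μ₀, R, r)`, WITH their certificates: (2.58) at zero
field for `G_jQ_j^*` and for its `L^{−j}`-difference quotient `K1_j` on every torus of the window, every level `1 ≤ j ≤ m + K`
with `L^jε ≤ 1` (mass `μ₀²`, cap `μ₀²`), in the rescaled fine distance `d_{XU}`; and the separation bound `e^{−¼δ₀r(ℓ)} ≤ C₁ℓ`
on `(0, 1]`. [cite: Balaban1982Higgs2, Prop. 2.2 (2.58) p.570, (2.7) p.558] [cite: Balaban1983RegularityDecay, Lemma 2.4 (2.35) p.582] -/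
structure Certified23 (Q : TorusConsts23) where
  /-- decay rate δ₀ -/
  δ : ℝ
  /-- kernel constant c₀ -/
  c₀ : ℝ
  /-- separation constant C₁ -/
  C₁ : ℝ
  δ_pos : 0 < δ
  c₀_nonneg : 0 ≤ c₀
  C₁_nonneg : 0 ≤ C₁
  /-- (2.58) for G_jQ_j^* at zero field on the torus -/
  kerGQ : ∀ (P : Params), P.d = Q.d → P.L = Q.L → ∀ j : ℕ, 1 ≤ j → j ≤ P.m + P.K → P.spacing j ≤ 1 →
    ∀ (x : Site P 0) (y : Site P j),
      |(Grs P Q.a (Q.μ₀ ^ 2) j * Qks P j) x y| ≤ c₀ * Real.exp (-(δ * dXU P j x ⟨j, y⟩))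
  /-- (2.58) for ∂^ηG_jQ_j^* at zero field on the torus (the kernel `K1_j`) -/
  kerK1 : ∀ (P : Params), P.d = Q.d → P.L = Q.L → ∀ j : ℕ, 1 ≤ j → j ≤ P.m + P.K → P.spacing j ≤ 1 →
    ∀ (μ : Fin P.d) (x : Site P 0) (y : Site P j),
      |K1 P Q.a (Q.μ₀ ^ 2) j μ x ⟨j, y⟩| ≤ c₀ * Real.exp (-(δ * dXU P j x ⟨j, y⟩))
  /-- the radius ½r(ℓ) beats ℓ⁻¹: e^{−¼δ₀r(ℓ)} ≤ C₁ℓ -/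
  sep : ∀ ℓ : ℝ, 0 < ℓ → ℓ ≤ 1 → Real.exp (-(δ / 4 * B2.rFn Q.Rr Q.r ℓ)) ≤ C₁ * ℓ

/-- `c₁e^{−δ₁t} ≤ c e^{−δt}` for `t ≥ 0`, `0 ≤ c₁ ≤ c`, `δ ≤ δ₁`. [folklore] -/
private theorem weaken {c₁ c δ₁ δ t : ℝ} (ht : 0 ≤ t) (hc₁ : 0 ≤ c₁) (hc : c₁ ≤ c) (hδ : δ ≤ δ₁) :
    c₁ * Real.exp (-(δ₁ * t)) ≤ c * Real.exp (-(δ * t)) :=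
  mul_le_mul hc (Real.exp_le_exp.mpr (by nlinarith)) (Real.exp_pos _).le (hc₁.trans hc)

/-- The mass cap of the torus theorems is met: `(L^jε)²μ₀² ≤ μ₀²` for `L^jε ≤ 1`. [folklore] -/
private theorem cap_of_spacing_le_one (P : Params) (j : ℕ) (hsp : P.spacing j ≤ 1) (μ₀ : ℝ) :
    P.spacing j ^ 2 * μ₀ ^ 2 ≤ μ₀ ^ 2 := by
  have hs := P.spacing_pos j
  have h1 : P.spacing j ^ 2 ≤ 1 := by nlinarith
  nlinarith [sq_nonneg μ₀]

/-- **The certified constants exist** for every valid window: `δ₀ = min`, `c₀ = max` of the constants of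
`B4Ineq116Torus.GQ_decay_torus` ((2.58) for `G_jQ_j^*`, converted from the block distance to `d_{XU}` at the price `e^{δ}`:
`d_{XU} ≤ |proj x − y| + 1`) and `K1_decay_torus_level` ((2.58) for `∂^ηG_jQ_j^*`), at mass `μ₀²`, cap `μ₀²`; `C₁` from
`B2Lemma23Proof.exists_C₁_rDecay4` at rate `δ₀`. [cite: Balaban1982Higgs2, Prop. 2.2 (2.58) p.570, (2.7) p.558] -/
theorem exists_certified23 (Q : TorusConsts23) (hQ : Q.Valid) : Nonempty (Certified23 Q) := by
  obtain ⟨κ₁, C, hκ₁, hC, h₁⟩ := GQ_decay_torus Q.d Q.L hQ.hd hQ.hL hQ.ha (Q.μ₀ ^ 2)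
  obtain ⟨δ₂, c₂, hδ₂, hc₂, h₂⟩ := K1_decay_torus_level Q.d Q.L hQ.hd hQ.hL hQ.ha (Q.μ₀ ^ 2)
  have hδ : 0 < min κ₁ δ₂ := lt_min hκ₁ hδ₂
  obtain ⟨C₁, hC₁⟩ := exists_C₁_rDecay4 hδ hQ.hRr hQ.hr
  have hC₁0 : 0 ≤ C₁ := by
    have h := hC₁ 1 one_pos le_rfl
    rw [mul_one] at h
    exact (Real.exp_pos _).le.trans h
  have hCe : 0 ≤ C * Real.exp κ₁ := mul_nonneg hC (Real.exp_pos _).le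
  refine ⟨⟨min κ₁ δ₂, max (C * Real.exp κ₁) c₂, C₁, hδ, le_max_of_le_left hCe, hC₁0, ?_, ?_, hC₁⟩⟩
  · intro P hPd hPL j hj hjm hsp x y
    have h := (h₁ P hPd hPL (Q.μ₀ ^ 2) (sq_nonneg _) j hj hjm (cap_of_spacing_le_one P j hsp Q.μ₀)).1 x y
    have hd := dXU_le_T_add_one (P := P) hjm x y
    have h' : |(Grs P Q.a (Q.μ₀ ^ 2) j * Qks P j) x y| ≤ C * Real.exp κ₁ * Real.exp (-(κ₁ * dXU P j x ⟨j, y⟩)) := by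
      refine h.trans ?_
      rw [mul_assoc, ← Real.exp_add]
      exact mul_le_mul_of_nonneg_left (Real.exp_le_exp.mpr (by nlinarith)) hC
    exact h'.trans (weaken (dXU_nonneg P j x ⟨j, y⟩) hCe (le_max_left _ _) (min_le_left _ _))
  · intro P hPd hPL j hj hjm hsp μ x y
    exact (h₂ P hPd hPL (Q.μ₀ ^ 2) (sq_nonneg _) j hj hjm (cap_of_spacing_le_one P j hsp Q.μ₀) μ x y).trans
      (weaken (dXU_nonneg P j x ⟨j, y⟩) hc₂ (le_max_right _ _) (min_le_right _ _))

/-- THE choice of certified constants for a valid window (once and for all, before any instance). [folklore] -/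
def cert23 (Q : TorusConsts23) (hQ : Q.Valid) : Certified23 Q := Classical.choice (exists_certified23 Q hQ)

/-- The fixed constants of the p247772 model family realised by the torus tower: `c₀ ↤ a·c₀` (`|a_k| ≤ a`), `δ ↤ δ₀`, `S =
e^{½δ₀}K_d(½δ₀)` (`B5Ineq137Torus.rowFine_le`), `r₁, r₂`, `K₁ = c₁Lμ₀/(a(1 − L⁻²))` ((2.63) against (2.55)₂), `K₂ =
e^{½δ₀}c₁LC₁/μ₀` (`B2Lemma23Proof.sep23_of_rDecay`), `K₃ = (1 + log L)^p` (`p(L^{k−1}ε) ≤ (1 + log L)^p·p(L^kε)`).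
[cite: Balaban1982Higgs2, Lemma 2.3 (2.59)–(2.64) p.571] -/
def consts23 (Q : TorusConsts23) (hQ : Q.Valid) : Consts23 where
  c₀ := Q.a * (cert23 Q hQ).c₀
  δ := (cert23 Q hQ).δ
  S := Real.exp ((cert23 Q hQ).δ / 2) * B4Sect5Proof.latticeConst Q.d ((cert23 Q hQ).δ / 2)
  r₁ := Q.r₁
  r₂ := Q.r₂
  K₁ := Q.c₁ * Q.L * Q.μ₀ / (Q.a * (1 - ((Q.L : ℝ) ^ 2)⁻¹))
  K₂ := Real.exp ((cert23 Q hQ).δ / 2) * Q.c₁ * Q.L * (cert23 Q hQ).C₁ / Q.μ₀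
  K₃ := (1 + Real.log Q.L) ^ Q.pexp

/-- The sign conditions of the model family hold for these constants. [cite: Balaban1982Higgs2, Lemma 2.3 p.571] -/
theorem consts23_valid (Q : TorusConsts23) (hQ : Q.Valid) : (consts23 Q hQ).Valid where
  c₀_nonneg := by have := hQ.ha; have := (cert23 Q hQ).c₀_nonneg; simp only [consts23]; positivity
  δ_pos := (cert23 Q hQ).δ_pos
  S_nonneg := by
    have := B4Sect5Proof.latticeConst_nonneg Q.d (half_pos (cert23 Q hQ).δ_pos).le
    simp only [consts23]; positivity
  r₁_nonneg := hQ.hr₁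
  r₂_nonneg := hQ.hr₂
  K₁_nonneg := by
    have hL1 : (1 : ℝ) < Q.L := by exact_mod_cast hQ.hL.2
    have h := ainf_pos hQ.ha hL1
    have := hQ.hc₁; have := hQ.hμ₀
    simp only [consts23]; positivity
  K₂_nonneg := by
    have := hQ.hμ₀; have := hQ.hc₁; have := (cert23 Q hQ).C₁_nonneg; simp only [consts23]; positivity
  K₃_nonneg := by
    have hL1 : (1 : ℝ) ≤ Q.L := by exact_mod_cast hQ.hL.2.le
    have := Real.log_nonneg hL1
    simp only [consts23]
    exact Real.rpow_nonneg (by linarith) _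

/-! ### The three scale lemmas: (2.63) against (2.55)₂, the radius ½r(L^kε), the one-step comparison of p(·) -/

/-- **(2.63) ⇒ the `kappa` field, without the side condition μ₀ℓ ≤ 1**: with κ = a_k/(a_k + μ₀²ℓ²) and tA = c₁L/(μ₀ℓ),
`|κ − 1|·tA = c₁Lμ₀ℓ/(a_k + μ₀²ℓ²) ≤ c₁Lμ₀/a₋` for `ℓ ≤ 1`, `a_k ≥ a₋ > 0`. [cite: Balaban1982Higgs2, (2.63) p.571; (2.55) p.570] -/
theorem kappa23_le {ainf ak μ₀ ℓ c₁ L : ℝ} (hainf : 0 < ainf) (hak : ainf ≤ ak) (hμ₀ : 0 < μ₀) (hℓ : 0 < ℓ) (hℓ1 : ℓ ≤ 1)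
    (hc₁ : 0 ≤ c₁) (hL : 0 ≤ L) :
    |ak / (ℓ ^ 2 * μ₀ ^ 2 + ak) - 1| * (c₁ * L / (μ₀ * ℓ)) ≤ c₁ * L * μ₀ / ainf := by
  have hak0 : 0 < ak := lt_of_lt_of_le hainf hak
  have hm : 0 ≤ ℓ ^ 2 * μ₀ ^ 2 := by positivity
  have hden : 0 < ℓ ^ 2 * μ₀ ^ 2 + ak := by positivity
  have habs : |ak / (ℓ ^ 2 * μ₀ ^ 2 + ak) - 1| = ℓ ^ 2 * μ₀ ^ 2 / (ℓ ^ 2 * μ₀ ^ 2 + ak) := by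
    rw [div_sub_one hden.ne', abs_div, abs_of_pos hden,
      show ak - (ℓ ^ 2 * μ₀ ^ 2 + ak) = -(ℓ ^ 2 * μ₀ ^ 2) by ring, abs_neg, abs_of_nonneg hm]
  rw [habs]
  calc ℓ ^ 2 * μ₀ ^ 2 / (ℓ ^ 2 * μ₀ ^ 2 + ak) * (c₁ * L / (μ₀ * ℓ))
      = ℓ * μ₀ * (c₁ * L) / (ℓ ^ 2 * μ₀ ^ 2 + ak) := by
        rw [div_mul_div_comm, div_eq_div_iff (mul_ne_zero hden.ne' (mul_ne_zero hμ₀.ne' hℓ.ne')) hden.ne']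
        ring
    _ ≤ ℓ * μ₀ * (c₁ * L) / ainf := div_le_div_of_nonneg_left (by positivity) hainf (by linarith)
    _ ≤ 1 * μ₀ * (c₁ * L) / ainf := by gcongr
    _ = c₁ * L * μ₀ / ainf := by ring

/-- **The one-step comparison of p(·)** behind «O(p(L^kε))» under restrictions at `p(L^{k−1}ε)`: `p(ℓ/L) ≤ (1 + log L)^p·p(ℓ)`
for `L ≥ 1`, `0 < ℓ ≤ 1` (`1 + log L + log ℓ⁻¹ ≤ (1 + log L)(1 + log ℓ⁻¹)`). [cite: Balaban1982Higgs2, p.557, Lemma 2.3 p.571] -/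
theorem pFn_div_le {b₀ p L ℓ : ℝ} (hb₀ : 0 ≤ b₀) (hp : 0 ≤ p) (hL : 1 ≤ L) (hℓ : 0 < ℓ) (hℓ1 : ℓ ≤ 1) :
    B2.pFn b₀ p (ℓ / L) ≤ (1 + Real.log L) ^ p * B2.pFn b₀ p ℓ := by
  unfold B2.pFn
  have hu : 0 ≤ Real.log ℓ⁻¹ := Real.log_nonneg ((one_le_inv₀ hℓ).mpr hℓ1)
  have hv : 0 ≤ Real.log L := Real.log_nonneg hL
  have hL0 : 0 < L := by linarith
  have hlog : Real.log (ℓ / L)⁻¹ = Real.log L + Real.log ℓ⁻¹ := by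
    rw [inv_div, div_eq_mul_inv, Real.log_mul hL0.ne' (inv_ne_zero hℓ.ne')]
  rw [hlog]
  have h1 : 1 + (Real.log L + Real.log ℓ⁻¹) ≤ (1 + Real.log L) * (1 + Real.log ℓ⁻¹) := by
    nlinarith [mul_nonneg hv hu]
  have h2 : (1 + (Real.log L + Real.log ℓ⁻¹)) ^ p ≤ ((1 + Real.log L) * (1 + Real.log ℓ⁻¹)) ^ p :=
    Real.rpow_le_rpow (by linarith) h1 hp
  rw [Real.mul_rpow (by linarith) (by linarith)] at h2
  calc b₀ * (1 + (Real.log L + Real.log ℓ⁻¹)) ^ p ≤ b₀ * ((1 + Real.log L) ^ p * (1 + Real.log ℓ⁻¹) ^ p) :=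
        mul_le_mul_of_nonneg_left h2 hb₀
    _ = (1 + Real.log L) ^ p * (b₀ * (1 + Real.log ℓ⁻¹) ^ p) := by ring

/-! ## §3. One step on one torus: the instance, all analytic fields discharged -/

/-- One fine step moves the rescaled distance `|x − y′|` (`x ∈ T_η`, `y′ ∈ T₁^{(k)}`) by at most `η = L^{−k}`:
`|d(x + e_μ, y′) − d(x, y′)| ≤ η` — the fact behind *"|(∂^η_xζ^{(k)})(b, y)| ≦ 1"* for distance cutoffs and behind the
one-step shifts of the decay bounds in (2.64). [cite: Balaban1982Higgs2, (2.44) p.566, (2.64) p.571] -/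
theorem abs_dXU_shift_sub_le (P : Params) (j : ℕ) (μ : Fin P.d) (x : Site P 0) (y' : Site P j) :
    |dXU P j (Site.shift x μ) ⟨j, y'⟩ - dXU P j x ⟨j, y'⟩| ≤ ((P.L : ℝ) ^ j)⁻¹ := by
  unfold dXU
  have hc : 0 < ((P.L : ℝ) ^ j)⁻¹ := inv_pos.mpr (pow_pos P.cast_L_pos _)
  have h1 := T_triangle P 0 (Site.shift x μ) x (fineU P ⟨j, y'⟩)
  have h2 := T_triangle P 0 x (Site.shift x μ) (fineU P ⟨j, y'⟩)
  have h3 := T_shift_le_one P x μ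
  have h4 : T P 0 (Site.shift x μ) x ≤ 1 := by rw [T_symm]; exact h3
  rw [← mul_sub, abs_mul, abs_of_pos hc]
  calc ((P.L : ℝ) ^ j)⁻¹ * |T P 0 (Site.shift x μ) (fineU P ⟨j, y'⟩) - T P 0 x (fineU P ⟨j, y'⟩)|
      ≤ ((P.L : ℝ) ^ j)⁻¹ * 1 :=
        mul_le_mul_of_nonneg_left (abs_sub_le_iff.mpr ⟨by linarith, by linarith⟩) hc.le
    _ = ((P.L : ℝ) ^ j)⁻¹ := mul_one _

/-- ONE INSTANCE of Lemma 2.3 realised on the torus: a volume `P` of the window (`P.d = d`, `P.L = L`), a step `k = j`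
(`1 ≤ j ≤ m + K`, `L^jε ≤ 1`), the regions `Λ₋₁^{(k−1)′} ⊇ Λ₂^{(k−1)′}` read as sets of sites of the unit lattice `T₁^{(k)}`
((2.55) holds on the first, (2.59)–(2.60) are asserted over the second) with the geometric standing assumption that the range
of `ζ^{(k)}` around `B^k(Λ₂^{(k−1)′})` (plus one step) lies in `Λ₋₁^{(k−1)′}`, one component `A` of the vector field on `T₁^{(k)}`,
and a cutoff `ζ^{(k)}(x, y)` with EXACTLY the printed properties of (2.44) p. 566: *"is "smooth" with respect to x in the sense
that |(∂^η_xζ^{(k)})(b, y)| ≦ 1, supp ζ^{(k)}(·, y) is contained in the set {x ∈ T_η : |x − y| < r(L^kε) − 2M} and ζ^{(k)}(x, y)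
= 1 if |x − y| ≦ ½r(L^kε)"* (and `|ζ^{(k)}| ≤ 1`), distances in the rescaled fine metric `d_{XU}`.
[cite: Balaban1982Higgs2, (2.44) p.566, (2.54)–(2.55) pp.569–570, Lemma 2.3 p.571] -/
structure TorusInst23 (Q : TorusConsts23) where
  /-- the torus parameters (d, L, m, K) -/
  P : Params
  hd : P.d = Q.d
  hL : P.L = Q.L
  /-- the step k (level of the unit lattice T₁^{(k)}) -/
  j : ℕ
  hj : 1 ≤ j
  hjm : j ≤ P.m + P.K
  /-- L^kε ≤ 1 -/
  hsp : P.spacing j ≤ 1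
  /-- Λ₋₁^{(k−1)′} ∩ T₁^{(k)}: where the restrictions (2.55) hold -/
  Λ₁ : Finset (Site P j)
  /-- Λ₂^{(k−1)′} ∩ T₁^{(k)}: where (2.59)–(2.60) are asserted -/
  Λ₂ : Finset (Site P j)
  sub : Λ₂ ⊆ Λ₁
  /-- the range of ζ^{(k)} (plus one fine step) around B^k(Λ₂^{(k−1)′}) lies in Λ₋₁^{(k−1)′} -/
  nbhd : ∀ (x : Site P 0) (y' : Site P j), Site.proj j j x ∈ Λ₂ →
    dXU P j x ⟨j, y'⟩ ≤ B2.rFn Q.Rr Q.r (P.spacing j) - 2 * Q.M + 1 → y' ∈ Λ₁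
  /-- one component of the vector field A on T₁^{(k)} -/
  A : Site P j → ℝ
  /-- the cutoff ζ^{(k)}(x, y) of (2.44) -/
  ζ : Site P 0 → Site P j → ℝ
  /-- |ζ^{(k)}| ≤ 1 -/
  zeta_abs : ∀ x y', |ζ x y'| ≤ 1
  /-- supp ζ^{(k)}(·, y) ⊂ {|x − y| < r(L^kε) − 2M} -/
  zeta_supp : ∀ x y', ζ x y' ≠ 0 → dXU P j x ⟨j, y'⟩ ≤ B2.rFn Q.Rr Q.r (P.spacing j) - 2 * Q.M
  /-- ζ^{(k)}(x, y) = 1 if |x − y| ≤ ½r(L^kε) -/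
  zeta_one : ∀ x y', dXU P j x ⟨j, y'⟩ ≤ B2.rFn Q.Rr Q.r (P.spacing j) / 2 → ζ x y' = 1
  /-- |(∂^η_xζ^{(k)})(b, y)| ≤ 1, η = L^{−k} -/
  zeta_lip : ∀ (μ : Fin P.d) (x : Site P 0) (y' : Site P j), |ζ (Site.shift x μ) y' - ζ x y'| ≤ ((P.L : ℝ) ^ j)⁻¹

namespace TorusInst23

variable {Q : TorusConsts23} (ι : TorusInst23 Q)

/-- `L^kε`. [cite: Balaban1982Higgs2, p.571] -/
def ℓ : ℝ := ι.P.spacing ι.j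

/-- `η = L^{−k}`, the spacing of the fine lattice `T_η` in the units of `T₁^{(k)}` (p. 570: *"η = L^{−k}"*).
[cite: Balaban1982Higgs2, p.570] -/
def η : ℝ := ((ι.P.L : ℝ) ^ ι.j)⁻¹

/-- `a_k`. [cite: Balaban1982Higgs1, (2.21) p.610] -/
def ak : ℝ := B1.aSeq Q.a ι.P.L ι.j

/-- The kernel `a_k(G_kQ_k^*)(x, y′)` of (2.54), `G_k` = the rescaled zero-field propagator `B5Display136Torus.Grs` at mass `μ₀²`.
[cite: Balaban1982Higgs2, (2.54) p.569, (2.44) p.566] -/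
def K (x : Site ι.P 0) (y' : Site ι.P ι.j) : ℝ := ι.ak * (Grs ι.P Q.a (Q.μ₀ ^ 2) ι.j * Qks ι.P ι.j) x y'

/-- `|x − y′|` for `x ∈ T_η`, `y′ ∈ T₁^{(k)}`: the rescaled fine sup torus distance `d_{XU}` (through corner representatives).
[cite: Balaban1984PropagatorsI, (1.136) p.40] -/
def d (x : Site ι.P 0) (y' : Site ι.P ι.j) : ℝ := dXU ι.P ι.j x ⟨ι.j, y'⟩

/-- `B^k(Λ₂^{(k−1)′})`: the fine points whose k-block lies in `Λ₂`. [cite: Balaban1982Higgs2, (2.59)–(2.60) p.571] -/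
def good : Finset (Site ι.P 0) := Finset.univ.filter fun x => Site.proj ι.j ι.j x ∈ ι.Λ₂

/-- **(2.54)** `A^{(k)}(x) = a_k(ζ^{(k)}G_kQ_k^*A)(x) = Σ_{y′∈T₁^{(k)}} ζ^{(k)}(x,y′)·a_k(G_kQ_k^*)(x,y′)·A(y′)` (one component).
[cite: Balaban1982Higgs2, (2.54) p.569] -/
def Ak (x : Site ι.P 0) : ℝ := ∑ y' : Site ι.P ι.j, ι.ζ x y' * ι.K x y' * ι.A y'

/-- `(∂^η_μA^{(k)})(x) = η⁻¹(A^{(k)}(x + ηe_μ) − A^{(k)}(x))`. [cite: Balaban1982Higgs2, (2.60) p.571] -/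
def dAk (μ : Fin ι.P.d) (x : Site ι.P 0) : ℝ := ι.η⁻¹ * (ι.Ak (Site.shift x μ) - ι.Ak x)

/-- The number `κ = a_kG_kQ_k^*1 = a_k/(a_k + μ₀²(L^kε)²)` of (2.63) (`aGQ_rowSum`; printed form `display263_value`).
[cite: Balaban1982Higgs2, (2.63) p.571] -/
def κ : ℝ := ι.ak / (ι.ℓ ^ 2 * Q.μ₀ ^ 2 + ι.ak)

/-- `r(L^kε) − 2M`, the support radius of `ζ^{(k)}(·, y)` ((2.44)). [cite: Balaban1982Higgs2, (2.44) p.566] -/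
def ρ : ℝ := B2.rFn Q.Rr Q.r ι.ℓ - 2 * Q.M

/-- `½r(L^kε)`, the radius within which `ζ^{(k)} = 1` ((2.44)). [cite: Balaban1982Higgs2, (2.44) p.566] -/
def ρ₁ : ℝ := B2.rFn Q.Rr Q.r ι.ℓ / 2

/-- `p(L^kε)`. [cite: Balaban1982Higgs2, p.557, (2.59) p.571] -/
def p : ℝ := B2.pFn Q.b₀ Q.pexp ι.ℓ

/-- `p(L^{k−1}ε) = p(L^kε/L)`, the scale of the restrictions (2.55). [cite: Balaban1982Higgs2, (2.55) p.570] -/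
def q : ℝ := B2.pFn Q.b₀ Q.pexp (ι.ℓ / Q.L)

/-- The threshold `c₁/(μ₀L^{k−1}ε) = c₁L/(μ₀L^kε)` of (2.55)₂. [cite: Balaban1982Higgs2, (2.55) p.570] -/
def tA : ℝ := Q.c₁ * Q.L / (Q.μ₀ * ι.ℓ)

/-- The field `A` CUT to `Λ₋₁^{(k−1)′}` (zero outside): the model of p247772 sums over all of `T₁^{(k)}` and states (2.55)₂ on
its summation range, so the instance carries `A·1_{Λ₋₁}` — invisible at the points where Lemma 2.3 is asserted (`Ak_model_eq`).
[cite: Balaban1982Higgs2, (2.55) p.570] -/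
def Acut (y' : Site ι.P ι.j) : ℝ := if y' ∈ ι.Λ₁ then ι.A y' else 0

/-- `0 < L^kε`. [folklore] -/
theorem ℓ_pos : 0 < ι.ℓ := ι.P.spacing_pos ι.j

/-- `L^kε ≤ 1`. [folklore] -/
theorem ℓ_le_one : ι.ℓ ≤ 1 := ι.hsp

/-- `0 < η = L^{−k}`. [cite: Balaban1982Higgs2, p.570] -/
theorem η_pos : 0 < ι.η := inv_pos.mpr (pow_pos ι.P.cast_L_pos _)

/-- `η = L^{−k} ≤ 1`. [cite: Balaban1982Higgs2, p.570] -/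
theorem η_le_one : ι.η ≤ 1 := inv_le_one_of_one_le₀ (one_le_pow₀ (one_lt_cast_L ι.P).le)

/-- `0 < a_k`. [cite: Balaban1982Higgs1, (2.21) p.610] -/
theorem ak_pos (hQ : Q.Valid) : 0 < ι.ak := B1.aSeq_pos hQ.ha (one_lt_cast_L ι.P) ι.hj

/-- `|a_k| ≤ a`. [cite: Balaban1982Higgs1, (2.21) p.610] -/
theorem abs_ak_le (hQ : Q.Valid) : |ι.ak| ≤ Q.a := abs_aSeq_le hQ.ha (one_lt_cast_L ι.P) ι.j

/-- `a(1 − L⁻²) ≤ a_k`. [cite: Balaban1982Higgs1, (2.21) p.610] -/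
theorem ainf_le_ak (hQ : Q.Valid) : Q.a * (1 - (((ι.P.L : ℝ)) ^ 2)⁻¹) ≤ ι.ak :=
  (B1.ainf_lt_aSeq hQ.ha (one_lt_cast_L ι.P) ι.j ι.hj).le

/-- `p(L^kε) ≥ 0` (`b₀ ≥ 0`, `0 < L^kε ≤ 1`; `B1Ineq353Proof.pFn_nonneg`). [cite: Balaban1982Higgs2, p.557, (2.59) p.571] -/
private theorem pk_nonneg (hQ : Q.Valid) : 0 ≤ ι.p := B1Ineq353Proof.pFn_nonneg hQ.hb₀ ι.ℓ_pos ι.ℓ_le_one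

/-- `0 < L^{k−1}ε = L^kε/L ≤ 1`. [cite: Balaban1982Higgs2, (2.55) p.570] -/
theorem ℓ_div_L_pos_le_one (hQ : Q.Valid) : 0 < ι.ℓ / Q.L ∧ ι.ℓ / Q.L ≤ 1 := by
  have hL1 : (1 : ℝ) ≤ Q.L := by exact_mod_cast hQ.hL.2.le
  have hL0 : (0 : ℝ) < Q.L := by linarith
  refine ⟨div_pos ι.ℓ_pos hL0, ?_⟩
  rw [div_le_one hL0]
  exact ι.ℓ_le_one.trans hL1

/-- `p(L^{k−1}ε) ≥ 0`. [cite: Balaban1982Higgs2, p.557, (2.55) p.570] -/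
theorem q_nonneg (hQ : Q.Valid) : 0 ≤ ι.q :=
  B1Ineq353Proof.pFn_nonneg hQ.hb₀ (ι.ℓ_div_L_pos_le_one hQ).1 (ι.ℓ_div_L_pos_le_one hQ).2

/-- `c₁L/(μ₀L^kε) ≥ 0`. [cite: Balaban1982Higgs2, (2.55) p.570] -/
theorem tA_nonneg (hQ : Q.Valid) : 0 ≤ ι.tA := by
  have := hQ.hμ₀; have := hQ.hc₁; have := ι.ℓ_pos; unfold tA; positivity

/-- `L^{k−1}ε = L^kε/L`. [cite: Balaban1982Higgs2, (2.55) p.570] -/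
theorem spacing_pred : ι.P.spacing (ι.j - 1) = ι.ℓ / Q.L := by
  have hL0 : (Q.L : ℝ) ≠ 0 := by rw [← ι.hL]; exact ι.P.cast_L_pos.ne'
  obtain ⟨i, hi⟩ : ∃ i, ι.j = i + 1 := ⟨ι.j - 1, by have := ι.hj; omega⟩
  unfold ℓ
  rw [hi, Nat.add_sub_cancel, ι.P.spacing_succ i, ι.hL]
  field_simp

/-- `q` IS `p(L^{k−1}ε)`. [cite: Balaban1982Higgs2, (2.55) p.570] -/
theorem q_eq : ι.q = B2.pFn Q.b₀ Q.pexp (ι.P.spacing (ι.j - 1)) := by rw [spacing_pred]; rfl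

/-- `tA` IS `c₁/(μ₀L^{k−1}ε)`. [cite: Balaban1982Higgs2, (2.55) p.570] -/
theorem tA_eq (hQ : Q.Valid) : ι.tA = Q.c₁ / (Q.μ₀ * ι.P.spacing (ι.j - 1)) := by
  rw [spacing_pred]
  have hL0 : (Q.L : ℝ) ≠ 0 := by
    have : (0 : ℝ) < Q.L := by exact_mod_cast (lt_trans Nat.zero_lt_one hQ.hL.2)
    exact this.ne'
  have hμ := hQ.hμ₀.ne'
  have hℓ := ι.ℓ_pos.ne'
  unfold tA
  field_simp

/-- `κ` is the printed (2.63) value `1 − μ₀²(L^kε)²/(a_k + μ₀²(L^kε)²)`. [cite: Balaban1982Higgs2, (2.63) p.571] -/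
theorem κ_eq_display263 (hQ : Q.Valid) : ι.κ = 1 - ι.ℓ ^ 2 * Q.μ₀ ^ 2 / (ι.ak + ι.ℓ ^ 2 * Q.μ₀ ^ 2) :=
  display263_value (ι.ak_pos hQ) (by positivity)

/-- **(2.63) for the instance**: the row sums of `a_kG_kQ_k^*` are the constant `κ` at EVERY fine point.
[cite: Balaban1982Higgs2, (2.63) p.571] -/
theorem K_rowSum (hQ : Q.Valid) (x : Site ι.P 0) : ∑ y' : Site ι.P ι.j, ι.K x y' = ι.κ := by
  unfold K κ ak ℓ
  rw [aGQ_rowSum hQ.ha (sq_nonneg _) ι.hj x]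

/-- One fine step moves `|x − y′|` by at most `η`: `|d(x + e_μ, y′) − d(x, y′)| ≤ η`. [cite: Balaban1982Higgs2, (2.64) p.571] -/
theorem abs_d_shift_sub_le (μ : Fin ι.P.d) (x : Site ι.P 0) (y' : Site ι.P ι.j) :
    |ι.d (Site.shift x μ) y' - ι.d x y'| ≤ ι.η :=
  abs_dXU_shift_sub_le ι.P ι.j μ x y'

/-- The cut is invisible within the range of `ζ^{(k)}` (plus one step) around `B^k(Λ₂^{(k−1)′})`. [cite: Balaban1982Higgs2, (2.55) p.570] -/
theorem Acut_eq_of_near {x : Site ι.P 0} (hx : Site.proj ι.j ι.j x ∈ ι.Λ₂) {y' : Site ι.P ι.j} (hy : ι.d x y' ≤ ι.ρ + 1) :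
    ι.Acut y' = ι.A y' := by
  unfold Acut
  rw [if_pos (ι.nbhd x y' hx hy)]

/-- The cut is invisible at the block of a good point. [cite: Balaban1982Higgs2, (2.55) p.570] -/
theorem Acut_proj {x : Site ι.P 0} (hx : Site.proj ι.j ι.j x ∈ ι.Λ₂) : ι.Acut (Site.proj ι.j ι.j x) = ι.A (Site.proj ι.j ι.j x) := by
  unfold Acut
  rw [if_pos (ι.sub hx)]

/-- `x ∈ B^k(Λ₂^{(k−1)′}) ↔` its block lies in `Λ₂^{(k−1)′}`. [cite: Balaban1982Higgs2, (2.59) p.571] -/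
theorem mem_good {x : Site ι.P 0} : x ∈ ι.good ↔ Site.proj ι.j ι.j x ∈ ι.Λ₂ := by
  simp [good]

end TorusInst23

/-- **THE INSTANCE WITH EVERY ANALYTIC FIELD DISCHARGED.**  One step on one torus read as a `B2Lemma23Proof.KernelModel23` over
the constants `consts23 Q hQ`: `T` = all of `T₁^{(k)}`, `good = B^k(Λ₂^{(k−1)′})`, `blk = proj`, `sh μ x = x + e_μ`, `η = L^{−k}`,
`K = a_k(G_kQ_k^*)` (`Grs`, `Qks` of the tower at mass `μ₀²`), `ζ = ζ^{(k)}`, `d = d_{XU}`, `A` = the field cut to `Λ₋₁^{(k−1)′}`,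
`κ` = (2.63), `ρ = r(L^kε) − 2M`, `ρ₁ = ½r(L^kε)`, `p = p(L^kε)`, `q = p(L^{k−1}ε)`, `tA = c₁/(μ₀L^{k−1}ε)`; the proof fields:
`kerK`/`kerK_sh` ⇐ (2.58) for `G_kQ_k^*` on the torus (`GQ_decay_torus`), `kerDK` ⇐ (2.58) for `∂^ηG_kQ_k^*`
(`K1_decay_torus_level` + `K1_mk`), `sumK`/`sumK_sh` ⇐ (2.63) (`K_rowSum`), `kappa` ⇐ `kappa23_le`, `sep` ⇐
`sep23_of_rDecay`, `q_le` ⇐ `pFn_div_le`, `summable` ⇐ `rowFine_le`, `d_le_sh`/`sh_le_d` ⇐ `abs_d_shift_sub_le`.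
[cite: Balaban1982Higgs2, Lemma 2.3 (2.59)–(2.64) p.571; (2.44) p.566; (2.54)–(2.55) pp.569–570; (2.58) p.570] -/
def toKM23 (Q : TorusConsts23) (hQ : Q.Valid) (ι : TorusInst23 Q) :
    KernelModel23 (consts23 Q hQ) (Site ι.P 0) (Site ι.P ι.j) (Fin ι.P.d) where
  T := Finset.univ
  good := ι.good
  blk := fun x => Site.proj ι.j ι.j x
  sh := fun μ x => Site.shift x μ
  η := ι.η
  K := ι.K
  ζ := ι.ζ
  d := ι.d
  A := ι.Acut
  κ := ι.κ
  ρ := ι.ρ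
  ρ₁ := ι.ρ₁
  p := ι.p
  q := ι.q
  tA := ι.tA
  blk_mem := fun _ _ => Finset.mem_univ _
  η_pos := ι.η_pos
  d_nonneg := fun x y' => dXU_nonneg ι.P ι.j x ⟨ι.j, y'⟩
  d_le_sh := fun μ x y' => by
    have h := ι.abs_d_shift_sub_le μ x y'
    have := ι.η_le_one
    rw [abs_le] at h
    linarith [h.1]
  sh_le_d := fun μ x y' => by
    have h := ι.abs_d_shift_sub_le μ x y'
    have := ι.η_le_one
    rw [abs_le] at h
    linarith [h.2]
  kerK := fun x _ y' _ => by
    show |ι.ak * (Grs ι.P Q.a (Q.μ₀ ^ 2) ι.j * Qks ι.P ι.j) x y'|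
      ≤ Q.a * (cert23 Q hQ).c₀ * Real.exp (-((cert23 Q hQ).δ * ι.d x y'))
    rw [abs_mul, mul_assoc]
    exact mul_le_mul (ι.abs_ak_le hQ) ((cert23 Q hQ).kerGQ ι.P ι.hd ι.hL ι.j ι.hj ι.hjm ι.hsp x y') (abs_nonneg _) hQ.ha.le
  kerK_sh := fun μ x _ y' _ => by
    show |ι.ak * (Grs ι.P Q.a (Q.μ₀ ^ 2) ι.j * Qks ι.P ι.j) (Site.shift x μ) y'|
      ≤ Q.a * (cert23 Q hQ).c₀ * Real.exp (-((cert23 Q hQ).δ * ι.d (Site.shift x μ) y'))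
    rw [abs_mul, mul_assoc]
    exact mul_le_mul (ι.abs_ak_le hQ) ((cert23 Q hQ).kerGQ ι.P ι.hd ι.hL ι.j ι.hj ι.hjm ι.hsp (Site.shift x μ) y')
      (abs_nonneg _) hQ.ha.le
  kerDK := fun μ x _ y' _ => by
    show |ι.ak * (Grs ι.P Q.a (Q.μ₀ ^ 2) ι.j * Qks ι.P ι.j) (Site.shift x μ) y'
        - ι.ak * (Grs ι.P Q.a (Q.μ₀ ^ 2) ι.j * Qks ι.P ι.j) x y'|
      ≤ ι.η * (Q.a * (cert23 Q hQ).c₀ * Real.exp (-((cert23 Q hQ).δ * ι.d x y')))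
    have hLj : (0 : ℝ) < (ι.P.L : ℝ) ^ ι.j := pow_pos ι.P.cast_L_pos _
    have hK1 := (cert23 Q hQ).kerK1 ι.P ι.hd ι.hL ι.j ι.hj ι.hjm ι.hsp μ x y'
    have hmk := K1_mk (P := ι.P) hQ.ha (sq_nonneg Q.μ₀) ι.hj μ x y'
    have hdiff : (Grs ι.P Q.a (Q.μ₀ ^ 2) ι.j * Qks ι.P ι.j) (Site.shift x μ) y'
        - (Grs ι.P Q.a (Q.μ₀ ^ 2) ι.j * Qks ι.P ι.j) x y'
        = ι.η * K1 ι.P Q.a (Q.μ₀ ^ 2) ι.j μ x ⟨ι.j, y'⟩ := by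
      rw [hmk]
      unfold TorusInst23.η
      field_simp
    rw [← mul_sub, hdiff, abs_mul, abs_mul, abs_of_pos ι.η_pos]
    have h0 : 0 ≤ ι.η := ι.η_pos.le
    calc |ι.ak| * (ι.η * |K1 ι.P Q.a (Q.μ₀ ^ 2) ι.j μ x ⟨ι.j, y'⟩|)
        ≤ Q.a * (ι.η * ((cert23 Q hQ).c₀ * Real.exp (-((cert23 Q hQ).δ * ι.d x y')))) :=
          mul_le_mul (ι.abs_ak_le hQ) (mul_le_mul_of_nonneg_left hK1 h0) (by positivity) hQ.ha.le
      _ = ι.η * (Q.a * (cert23 Q hQ).c₀ * Real.exp (-((cert23 Q hQ).δ * ι.d x y'))) := by ring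
  zeta_abs := ι.zeta_abs
  zeta_supp := fun x y' _ h => ι.zeta_supp x y' h
  zeta_one := fun x y' _ h => ι.zeta_one x y' h
  zeta_lip := fun μ x y' _ => ι.zeta_lip μ x y'
  sumK := fun x _ => ι.K_rowSum hQ x
  sumK_sh := fun μ x _ => ι.K_rowSum hQ (Site.shift x μ)
  p_nonneg := ι.pk_nonneg hQ
  q_nonneg := ι.q_nonneg hQ
  q_le := by
    show ι.q ≤ (1 + Real.log Q.L) ^ Q.pexp * ι.p
    have hL1 : (1 : ℝ) ≤ Q.L := by exact_mod_cast hQ.hL.2.le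
    exact pFn_div_le hQ.hb₀ hQ.hpexp hL1 ι.ℓ_pos ι.ℓ_le_one
  tA_nonneg := ι.tA_nonneg hQ
  kappa := by
    show |ι.κ - 1| * ι.tA ≤ Q.c₁ * Q.L * Q.μ₀ / (Q.a * (1 - ((Q.L : ℝ) ^ 2)⁻¹))
    have hL1 : (1 : ℝ) < Q.L := by exact_mod_cast hQ.hL.2
    have hainf := ainf_pos hQ.ha hL1
    have hle : Q.a * (1 - ((Q.L : ℝ) ^ 2)⁻¹) ≤ ι.ak := by
      have h := ι.ainf_le_ak hQ
      rwa [ι.hL] at h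
    unfold TorusInst23.κ TorusInst23.tA
    exact kappa23_le hainf hle hQ.hμ₀ ι.ℓ_pos ι.ℓ_le_one hQ.hc₁ (Nat.cast_nonneg _)
  sep := by
    show Real.exp (-((cert23 Q hQ).δ / 2 * (ι.ρ₁ - 1))) * ι.tA
      ≤ Real.exp ((cert23 Q hQ).δ / 2) * Q.c₁ * Q.L * (cert23 Q hQ).C₁ / Q.μ₀
    unfold TorusInst23.tA
    refine sep23_of_rDecay (cert23 Q hQ).δ_pos.le hQ.hμ₀ ι.ℓ_pos hQ.hc₁ (Nat.cast_nonneg _) ?_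
      ((cert23 Q hQ).sep ι.ℓ ι.ℓ_pos ι.ℓ_le_one)
    unfold TorusInst23.ρ₁
    linarith
  summable := fun x => by
    show ∑ y' ∈ Finset.univ, Real.exp (-((cert23 Q hQ).δ / 2 * ι.d x y'))
      ≤ Real.exp ((cert23 Q hQ).δ / 2) * B4Sect5Proof.latticeConst Q.d ((cert23 Q hQ).δ / 2)
    have h := rowFine_le ι.P ι.hjm (half_pos (cert23 Q hQ).δ_pos) x
    rw [ι.hd] at h
    exact h

/-! ## §4. Row B2.Lem2.3 for Bałaban's `A^{(k)}` on the torus: the decl of record (r02) and the twin (r14) -/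

namespace TorusInst23

variable {Q : TorusConsts23} (ι : TorusInst23 Q)

/-- «the restrictions (2.55)» ON `Λ₋₁^{(k−1)′}`, at scale `p(L^{k−1}ε)`: (2.55)₂ `|A(y′)| ≤ (c₁/(μ₀L^{k−1}ε))p(L^{k−1}ε)` for
`y′ ∈ Λ₋₁^{(k−1)′}`, and (2.55)₁ `|(∂A)(b)| ≤ c₁p(L^{k−1}ε)` in the INTEGRATED form of p247772 — along lattice paths, for the
sites within the range of `ζ^{(k)}(x, ·)` (plus one step) around a point `x ∈ B^k(y)`, `y ∈ Λ₂^{(k−1)′}`: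
`|A(y′) − A(y)| ≤ p(L^{k−1}ε)(r₁ + r₂|x − y′|)`. [cite: Balaban1982Higgs2, (2.55) p.570; Lemma 2.3 p.571] -/
structure RestrT : Prop where
  /-- (2.55)₂ on Λ₋₁^{(k−1)′} -/
  bound : ∀ y' ∈ ι.Λ₁, |ι.A y'| ≤ ι.tA * ι.q
  /-- (2.55)₁, integrated, near B^k(Λ₂^{(k−1)′}) -/
  lipschitz : ∀ x : Site ι.P 0, Site.proj ι.j ι.j x ∈ ι.Λ₂ → ∀ y' : Site ι.P ι.j, ι.d x y' ≤ ι.ρ + 1 →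
    |ι.A y' - ι.A (Site.proj ι.j ι.j x)| ≤ ι.q * (Q.r₁ + Q.r₂ * ι.d x y')

end TorusInst23

/-- The model's restriction predicate IS (2.55) on `Λ₋₁^{(k−1)′}` (the cut being invisible where the predicate looks).
[cite: Balaban1982Higgs2, (2.55) p.570] -/
theorem restr_iff (Q : TorusConsts23) (hQ : Q.Valid) (ι : TorusInst23 Q) : (toKM23 Q hQ ι).Restr ↔ ι.RestrT := by
  constructor
  · intro h
    refine ⟨fun y' hy' => ?_, fun x hx y' hy => ?_⟩
    · have hb := h.bound y' (Finset.mem_univ _)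
      change |ι.Acut y'| ≤ ι.tA * ι.q at hb
      unfold TorusInst23.Acut at hb
      rwa [if_pos hy'] at hb
    · have hl := h.lipschitz x (ι.mem_good.mpr hx) y' (Finset.mem_univ _) hy
      change |ι.Acut y' - ι.Acut (Site.proj ι.j ι.j x)| ≤ ι.q * (Q.r₁ + Q.r₂ * ι.d x y') at hl
      rwa [ι.Acut_eq_of_near hx hy, ι.Acut_proj hx] at hl
  · intro h
    refine ⟨fun y' _ => ?_, fun x hx y' _ hy => ?_⟩
    · change |ι.Acut y'| ≤ ι.tA * ι.q
      unfold TorusInst23.Acut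
      split_ifs with hy'
      · exact h.bound y' hy'
      · rw [abs_zero]; exact mul_nonneg (ι.tA_nonneg hQ) (ι.q_nonneg hQ)
    · have hx' := ι.mem_good.mp hx
      change |ι.Acut y' - ι.Acut (Site.proj ι.j ι.j x)| ≤ ι.q * (Q.r₁ + Q.r₂ * ι.d x y')
      rw [ι.Acut_eq_of_near hx' hy, ι.Acut_proj hx']
      exact h.lipschitz x hx' y' hy

/-- The model's `A^{(k)}` (built on the cut field) IS Bałaban's (2.54) at every point within one step of `B^k(Λ₂^{(k−1)′})`:
the support of `ζ^{(k)}(x, ·)` lies in `Λ₋₁^{(k−1)′}` there. [cite: Balaban1982Higgs2, (2.54) p.569, (2.44) p.566] -/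
theorem Ak_model_eq (Q : TorusConsts23) (hQ : Q.Valid) (ι : TorusInst23 Q) {x x₀ : Site ι.P 0}
    (hx₀ : Site.proj ι.j ι.j x₀ ∈ ι.Λ₂) (hxx₀ : ∀ y', ι.d x₀ y' ≤ ι.d x y' + 1) :
    (toKM23 Q hQ ι).Ak x = ι.Ak x := by
  change ∑ y' ∈ Finset.univ, ι.ζ x y' * ι.K x y' * ι.Acut y' = ∑ y' : Site ι.P ι.j, ι.ζ x y' * ι.K x y' * ι.A y'
  refine Finset.sum_congr rfl fun y' _ => ?_
  by_cases hζ : ι.ζ x y' = 0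
  · rw [hζ]; ring
  · have hd : ι.d x y' ≤ ι.ρ := ι.zeta_supp x y' hζ
    rw [ι.Acut_eq_of_near hx₀ (by linarith [hxx₀ y'])]

/-- **(2.59) POINTWISE for Bałaban's `A^{(k)}` on the torus**: under (2.55) on `Λ₋₁^{(k−1)′}`, for every `x ∈ B^k(y)`,
`y ∈ Λ₂^{(k−1)′}`: `|A^{(k)}(x) − A(y)| ≤ 𝒞·p(L^kε)` with `𝒞 = Consts23.O1 (consts23 Q hQ)` uniform over the window.
[cite: Balaban1982Higgs2, Lemma 2.3 (2.59) p.571] -/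
theorem lemma23_torus_pointwise (Q : TorusConsts23) (hQ : Q.Valid) (ι : TorusInst23 Q) (hR : ι.RestrT)
    {x : Site ι.P 0} (hx : Site.proj ι.j ι.j x ∈ ι.Λ₂) :
    |ι.Ak x - ι.A (Site.proj ι.j ι.j x)| ≤ (consts23 Q hQ).O1 * ι.p := by
  have h := (toKM23 Q hQ ι).lemma23_pointwise (consts23_valid Q hQ) ((restr_iff Q hQ ι).mpr hR) (ι.mem_good.mpr hx)
  rw [Ak_model_eq Q hQ ι hx (fun y' => by linarith)] at h
  change |ι.Ak x - ι.Acut (Site.proj ι.j ι.j x)| ≤ (consts23 Q hQ).O1 * ι.p at h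
  rwa [ι.Acut_proj hx] at h

/-- **(2.60) POINTWISE for Bałaban's `A^{(k)}` on the torus**: under (2.55) on `Λ₋₁^{(k−1)′}`, for every `x ∈ B^k(Λ₂^{(k−1)′})`
and every direction `μ`: `|(∂^η_μA^{(k)})(x)| ≤ 𝒞·p(L^kε)`. [cite: Balaban1982Higgs2, Lemma 2.3 (2.60) p.571] -/
theorem lemma23_torus_deriv_pointwise (Q : TorusConsts23) (hQ : Q.Valid) (ι : TorusInst23 Q) (hR : ι.RestrT)
    (μ : Fin ι.P.d) {x : Site ι.P 0} (hx : Site.proj ι.j ι.j x ∈ ι.Λ₂) :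
    |ι.dAk μ x| ≤ (consts23 Q hQ).O1 * ι.p := by
  have h := (toKM23 Q hQ ι).lemma23_deriv_pointwise (consts23_valid Q hQ) ((restr_iff Q hQ ι).mpr hR) μ
    (ι.mem_good.mpr hx)
  have hsh : ∀ y', ι.d x y' ≤ ι.d (Site.shift x μ) y' + 1 := fun y' => by
    have h1 := ι.abs_d_shift_sub_le μ x y'
    have := ι.η_le_one
    rw [abs_le] at h1
    linarith [h1.1]
  change |ι.η⁻¹ * ((toKM23 Q hQ ι).Ak (Site.shift x μ) - (toKM23 Q hQ ι).Ak x)| ≤ (consts23 Q hQ).O1 * ι.p at h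
  rwa [Ak_model_eq Q hQ ι hx hsh, Ak_model_eq Q hQ ι hx (fun y' => by linarith)] at h

/-- The family of all torus instances of the window, read through the row's carrier `B2Sect2Statements.L23Setting` (decl of
record): `p = p(L^kε)`, `restr255` = (2.55) on `Λ₋₁^{(k−1)′}` (`RestrT`), `dev259a` = sup over `x ∈ B^k(Λ₂^{(k−1)′})` of
`|A^{(k)}(x) − A(y)|`, `dev259b` = the same in the reading `(Q_k^*A)(x) = A(y)`, `dev260` = sup of `|(∂^η_μA^{(k)})(x)|`.
[cite: Balaban1982Higgs2, Lemma 2.3 (2.59)–(2.60) p.571] -/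
def famTorus23 (Q : TorusConsts23) (ι : TorusInst23 Q) : B2Sect2Statements.L23Setting where
  p := ι.p
  restr255 := ι.RestrT
  dev259a := ⨆ x : ↥ι.good, |ι.Ak x.1 - ι.A (Site.proj ι.j ι.j x.1)|
  dev259b := ⨆ x : ↥ι.good, |ι.Ak x.1 - ι.A (Site.proj ι.j ι.j x.1)|
  dev260 := ⨆ i : Fin ι.P.d × ↥ι.good, |ι.dAk i.1 i.2.1|

/-- **ROW B2.Lem2.3 — LEMMA 2.3 (2.59)–(2.60) AS TYPED BY THE DECL OF RECORD, FOR BAŁABAN'S `A^{(k)} = a_kζ^{(k)}G_kQ_k^*A` ON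
THE TORUS**: for every valid window the family of ALL steps `k` on ALL tori of `Setup` (every volume, every pair of regions,
every field component `A`, every cutoff with the printed properties (2.44)), with `G_k` the GENUINE zero-field propagator of the
tower at mass `μ₀²`, satisfies `B2Sect2Statements.Lemma23Printed` with the uniform constant `𝒞 = Consts23.O1 (consts23 Q hQ)` —
Proposition 2.2 for `G_kQ_k^*`, `∂^ηG_kQ_k^*` and (2.63) being theorems here, only (2.55) (`restr255`) is assumed, as in print.
[cite: Balaban1982Higgs2, Lemma 2.3 (2.59)–(2.60) p.571] -/
theorem lemma23Printed_torus (Q : TorusConsts23) (hQ : Q.Valid) :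
    B2Sect2Statements.Lemma23Printed (famTorus23 Q) := by
  have hO : 0 ≤ (consts23 Q hQ).O1 := Consts23.O1_nonneg (consts23_valid Q hQ)
  refine ⟨(consts23 Q hQ).O1, fun ι hR => ⟨?_, ?_, ?_⟩⟩
  · exact Real.iSup_le (fun x => lemma23_torus_pointwise Q hQ ι hR (ι.mem_good.mp x.2)) (mul_nonneg hO (ι.pk_nonneg hQ))
  · exact Real.iSup_le (fun x => lemma23_torus_pointwise Q hQ ι hR (ι.mem_good.mp x.2)) (mul_nonneg hO (ι.pk_nonneg hQ))
  · exact Real.iSup_le (fun i => lemma23_torus_deriv_pointwise Q hQ ι hR i.1 (ι.mem_good.mp i.2.2))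
      (mul_nonneg hO (ι.pk_nonneg hQ))

/-- The same family read through r14's twin carrier `B2StepK.L23Setting` (per-point form: `inL2 y` ↤ `y ∈ Λ₂^{(k−1)′}`, `blk =
proj`, `Ak = A^{(k)}` of (2.54), `QsA x = A(y)` for `x ∈ B^k(y)`, `dAk μ x = |(∂^η_μA^{(k)})(x)|`, `restr` = (2.55) on `Λ₋₁`).
[cite: Balaban1982Higgs2, Lemma 2.3 (2.59)–(2.60) p.571] -/
def famTorus23StepK (Q : TorusConsts23) (ι : TorusInst23 Q) : B2StepK.L23Setting where
  X := Site ι.P 0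
  Y := Site ι.P ι.j
  Dir := Fin ι.P.d
  blk := fun x => Site.proj ι.j ι.j x
  inL2 := fun y => y ∈ ι.Λ₂
  Ak := ι.Ak
  A := ι.A
  QsA := fun x => ι.A (Site.proj ι.j ι.j x)
  dAk := fun μ x => |ι.dAk μ x|
  p := ι.p
  restr := ι.RestrT

/-- **ROW B2.Lem2.3 FOR r14's TWIN STATEMENT `B2StepK.Lemma23Printed`, for Bałaban's `A^{(k)}` on the torus** (same constant).
[cite: Balaban1982Higgs2, Lemma 2.3 (2.59)–(2.60) p.571] -/
theorem lemma23Printed_torus_StepK (Q : TorusConsts23) (hQ : Q.Valid) :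
    B2StepK.Lemma23Printed (famTorus23StepK Q) :=
  ⟨(consts23 Q hQ).O1, fun ι hR =>
    ⟨fun _ hx => ⟨lemma23_torus_pointwise Q hQ ι hR hx, lemma23_torus_pointwise Q hQ ι hR hx⟩,
      fun μ _ hx => lemma23_torus_deriv_pointwise Q hQ ι hR μ hx⟩⟩

/-! ### Unfolding lemmas: what the family's fields are -/

/-- The family's `p` is `p(L^kε)`. [cite: Balaban1982Higgs2, (2.59) p.571] -/
theorem famTorus23_p (Q : TorusConsts23) (ι : TorusInst23 Q) :
    (famTorus23 Q ι).p = B2.pFn Q.b₀ Q.pexp (ι.P.spacing ι.j) := rfl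

/-- The family's hypothesis is (2.55) on `Λ₋₁^{(k−1)′}`. [cite: Balaban1982Higgs2, (2.55) p.570] -/
theorem famTorus23_restr (Q : TorusConsts23) (ι : TorusInst23 Q) : (famTorus23 Q ι).restr255 = ι.RestrT := rfl

/-- The model's kernel `K` IS `a_k(G_kQ_k^*)(x, y′)` with `G_k = (−Δ^η + μ₀²(L^kε)² + a_kQ_k^*Q_k)⁻¹` the zero-field propagator.
[cite: Balaban1982Higgs2, (2.54) p.569] [cite: Balaban1982Higgs1, (2.22) p.610] -/
theorem toKM23_K (Q : TorusConsts23) (hQ : Q.Valid) (ι : TorusInst23 Q) (x : Site ι.P 0) (y' : Site ι.P ι.j) :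
    (toKM23 Q hQ ι).K x y' = B1.aSeq Q.a ι.P.L ι.j * ((Marg ι.P Q.a (Q.μ₀ ^ 2) ι.j)⁻¹ * Qks ι.P ι.j) x y' := rfl

/-- The model's `κ` IS the printed (2.63) value. [cite: Balaban1982Higgs2, (2.63) p.571] -/
theorem toKM23_κ (Q : TorusConsts23) (hQ : Q.Valid) (ι : TorusInst23 Q) :
    (toKM23 Q hQ ι).κ = 1 - ι.ℓ ^ 2 * Q.μ₀ ^ 2 / (ι.ak + ι.ℓ ^ 2 * Q.μ₀ ^ 2) := ι.κ_eq_display263 hQ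

/-! ## §5. Non-vacuity: a cutoff with the properties (2.44) exists; the window and the hypotheses are inhabited -/

/-- A CANONICAL CUTOFF with the printed properties (2.44): `ζ(t) = min(1, max(0, ρ₁ + 1 − t))` as a function of the distance
`t = |x − y|` — equal to `1` for `t ≤ ρ₁`, vanishing for `t > ρ₁ + 1`, `1`-Lipschitz in `t`. [cite: Balaban1982Higgs2, (2.44) p.566] -/
def zetaPL (ρ₁ t : ℝ) : ℝ := min 1 (max 0 (ρ₁ + 1 - t))

/-- `|ζ| ≤ 1`. [cite: Balaban1982Higgs2, (2.44) p.566] -/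
theorem abs_zetaPL_le (ρ₁ t : ℝ) : |zetaPL ρ₁ t| ≤ 1 := by
  unfold zetaPL
  rw [abs_le]
  constructor
  · have : 0 ≤ min 1 (max 0 (ρ₁ + 1 - t)) := le_min zero_le_one (le_max_left _ _)
    linarith
  · exact min_le_left _ _

/-- `ζ(t) ≠ 0 ⇒ t ≤ ρ₁ + 1`. [cite: Balaban1982Higgs2, (2.44) p.566] -/
theorem zetaPL_supp {ρ₁ t : ℝ} (h : zetaPL ρ₁ t ≠ 0) : t ≤ ρ₁ + 1 := by
  by_contra hlt
  push Not at hlt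
  apply h
  unfold zetaPL
  rw [max_eq_left (by linarith), min_eq_right zero_le_one]

/-- `t ≤ ρ₁ ⇒ ζ(t) = 1`. [cite: Balaban1982Higgs2, (2.44) p.566] -/
theorem zetaPL_one {ρ₁ t : ℝ} (h : t ≤ ρ₁) : zetaPL ρ₁ t = 1 := by
  unfold zetaPL
  rw [min_eq_left]
  exact le_trans (by linarith) (le_max_right _ _)

/-- `ζ` is `1`-Lipschitz in the distance. [cite: Balaban1982Higgs2, (2.44) p.566] -/
theorem abs_zetaPL_sub_le (ρ₁ t s : ℝ) : |zetaPL ρ₁ t - zetaPL ρ₁ s| ≤ |t - s| := by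
  unfold zetaPL
  calc |min 1 (max 0 (ρ₁ + 1 - t)) - min 1 (max 0 (ρ₁ + 1 - s))|
      ≤ max |(1 : ℝ) - 1| |max 0 (ρ₁ + 1 - t) - max 0 (ρ₁ + 1 - s)| := abs_min_sub_min_le_max _ _ _ _
    _ = |max 0 (ρ₁ + 1 - t) - max 0 (ρ₁ + 1 - s)| := by
        rw [sub_self, abs_zero, max_eq_right (abs_nonneg _)]
    _ ≤ max |(0 : ℝ) - 0| |(ρ₁ + 1 - t) - (ρ₁ + 1 - s)| := abs_max_sub_max_le_max _ _ _ _
    _ = |t - s| := by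
        rw [sub_self, abs_zero, max_eq_right (abs_nonneg _), show ρ₁ + 1 - t - (ρ₁ + 1 - s) = -(t - s) by ring, abs_neg]

/-- The window `d = 3`, `L = 3`, `a = 1`, `μ₀ = 1`, `R = 4`, `r = 2`, `M = ½`, `b₀ = 1`, `p = 3`, `c₁ = 1`, `r₁ = r₂ = 1`. [folklore] -/
def Q₀ : TorusConsts23 := ⟨3, 3, 1, 1, 4, 2, 1 / 2, 1, 3, 1, 1, 1⟩

/-- The window `Q₀` is valid. [folklore] -/
private theorem Q₀_valid : Q₀.Valid where
  hd := by decide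
  hL := ⟨by decide, by decide⟩
  ha := by norm_num [Q₀]
  hμ₀ := by norm_num [Q₀]
  hRr := by norm_num [Q₀]
  hr := by norm_num [Q₀]
  hM := by norm_num [Q₀]
  hb₀ := by norm_num [Q₀]
  hpexp := by norm_num [Q₀]
  hc₁ := by norm_num [Q₀]
  hr₁ := by norm_num [Q₀]
  hr₂ := by norm_num [Q₀]

/-- The torus `d = 3`, `L = 3`, `m = K = 1` (ε = 1/3; `T_η` has 18 sites per direction, `T₁^{(1)}` has 6). [folklore] -/
def P₀ : Params := ⟨3, 3, 1, 1, by decide, ⟨by decide, by decide⟩⟩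

/-- `L^1ε = 3·3⁻¹ = 1`. [folklore] -/
private theorem P₀_spacing_one : P₀.spacing 1 = 1 := by
  simp [Params.spacing, Params.eps, P₀]

/-- `r(L^1ε) = r(1) = 4` on `P₀`. [folklore] -/
private theorem rFn_one : B2.rFn Q₀.Rr Q₀.r (P₀.spacing 1) = 4 := by
  simp [B2.rFn, P₀_spacing_one, Q₀]

/-- An instance at step `k = 1` on `P₀`: `Λ₋₁ = Λ₂ = T₁^{(1)}`, `A = 0`, the canonical cutoff `ζ^{(1)}(x, y) = ζ_{PL}(½r(1); |x − y|)`
(`= 1` within `ρ₁ = 2`, supported within `ρ₁ + 1 = 3 = r(1) − 2M`, `η`-Lipschitz since `|x − y|` moves by `≤ η` per fine step). [folklore] -/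
def ι₁ : TorusInst23 Q₀ where
  P := P₀
  hd := rfl
  hL := rfl
  j := 1
  hj := le_rfl
  hjm := by decide
  hsp := by rw [P₀_spacing_one]
  Λ₁ := Finset.univ
  Λ₂ := Finset.univ
  sub := Finset.subset_univ _
  nbhd := fun _ _ _ _ => Finset.mem_univ _
  A := fun _ => 0
  ζ := fun x y' => zetaPL 2 (dXU P₀ 1 x ⟨1, y'⟩)
  zeta_abs := fun x y' => abs_zetaPL_le _ _
  zeta_supp := fun x y' h => by
    rw [rFn_one]
    have := zetaPL_supp h
    norm_num [Q₀]
    linarith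
  zeta_one := fun x y' h => by
    rw [rFn_one] at h
    exact zetaPL_one (by linarith)
  zeta_lip := fun μ x y' => (abs_zetaPL_sub_le 2 _ _).trans (abs_dXU_shift_sub_le P₀ 1 μ x y')

/-- the index type of the family is inhabited. [folklore] -/
instance : Nonempty (TorusInst23 Q₀) := ⟨ι₁⟩

/-- `B^1(Λ₂)` is all of `T_η` on `ι₁`: (2.59)–(2.60) are asserted at every fine point. [folklore] -/
private theorem ι₁_good (x : Site P₀ 0) : Site.proj 1 1 x ∈ ι₁.Λ₂ := Finset.mem_univ _

/-- the restrictions (2.55) are satisfiable on `ι₁` (the zero field), so `lemma23Printed_torus` asserts its conclusion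
non-vacuously there: a valid window, an instance, an admissible cutoff, a satisfied hypothesis, every point good. [folklore] -/
private theorem ι₁_restr : ι₁.RestrT := by
  have hq : 0 ≤ ι₁.q := ι₁.q_nonneg Q₀_valid
  have ht : 0 ≤ ι₁.tA := ι₁.tA_nonneg Q₀_valid
  refine ⟨fun y' _ => ?_, fun x _ y' _ => ?_⟩
  · show |(0 : ℝ)| ≤ ι₁.tA * ι₁.q
    rw [abs_zero]; positivity
  · show |(0 : ℝ) - 0| ≤ ι₁.q * (Q₀.r₁ + Q₀.r₂ * ι₁.d x y')
    rw [sub_zero, abs_zero]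
    have : 0 ≤ ι₁.d x y' := dXU_nonneg _ _ _ _
    have h1 : (0 : ℝ) ≤ Q₀.r₁ := Q₀_valid.hr₁
    have h2 : (0 : ℝ) ≤ Q₀.r₂ := Q₀_valid.hr₂
    positivity

/-- non-vacuity of the row statement for the physical window: the conclusion (2.60) evaluated on `ι₁` at a point. -/
example (μ : Fin P₀.d) (x : Site P₀ 0) : |ι₁.dAk μ x| ≤ (consts23 Q₀ Q₀_valid).O1 * ι₁.p :=
  lemma23_torus_deriv_pointwise Q₀ Q₀_valid ι₁ ι₁_restr μ (ι₁_good x)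

end

end Literature.MathematicalPhysics.QuantumFieldTheory.Balaban1983to89.B2Lemma23Torus
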